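import Summits.HubbardSuperconductivity.HubbardSuperconductivity.Theorems.KacWindowPenaltyWindowGapNormalForms
import Summits.HubbardSuperconductivity.HubbardSuperconductivity.Theorems.FunctionFieldCertificateWindowInfraredBoundReductions
import Literature.MathematicalPhysics.QuantumLattice.SectorEigenvalueContinuation

/-!
# Route `KacWindowPenalty` — crux `WindowGap` (stmt-HubbardSuperconductivity-1088):
# the two-sided sandwich, the penalised normal forms, and the a-priori ceiling

The crux `WindowGap` asks, at some `U > 0`, `δ ∈ (0, 1/2)`, for an EXTENSIVE excess
`λ(Cε + a)L² ≤ g_L(λ) − g_L(0)` of the sector ground energy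
`g_L(λ) := minEnergyOn (H_L + λ W_ε) K_L` of the Kac-window-penalised Hubbard torus
(`H_L = hubbardTorus 2 L 1 U`, `K_L = szSector N_L 0`, `N_L = 2⌊(1−δ)L²/2⌋`,
`W_ε = L⁻² Σ_{|q_m| ≤ ε} Δ_d(m)ᴴ Δ_d(m)` the Kac-window pair penalty, `Δ_d(m) = pairFieldAt
dWaveFormFactor L m`). Since `g_L` is an infimum of affine functions of `λ`, it is sandwiched by
its chords at BOTH ends; this module records the finite-dimensional consequences, with no physics:

* `smul_re_expect_le_minEnergyOn_add_smul_sub` — the REVERSE SANDWICH: for a unit minimiser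
  `ψ_λ ∈ K` of `H + λA` on `K`, `λ Re ⟨ψ_λ, A ψ_λ⟩ ≤ minEnergyOn (H + λA) K − minEnergyOn H K`
  (variational principle for `H` at `ψ_λ`). Together with the route's `Sandwich`
  (`chord_div_le_re_expect_of_eigen`: `… ≤ λ Re ⟨ψ₀, A ψ₀⟩` for a ground state `ψ₀` of `H`) this
  pins the crux between two expectations of the window operator:
  `λ · Re ⟨ψ_λ, W_ε ψ_λ⟩ ≤ gap ≤ λ · Re ⟨ψ₀, W_ε ψ₀⟩`.
* `exists_unit_re_rayleigh_eq_minEnergyOn` — minimisers exist (`K` finite-dimensional, the unit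
  sphere compact), so hypotheses quantified over ALL minimisers are usable.
* `windowGapAt_of_penalisedWindowWeight`, `windowGap_of_penalisedWindowWeight` — SUFFICIENT
  NORMAL FORM: if at `(U, δ)`, for every `C ≥ 0`, `ε₀ > 0`, some `ε ≤ ε₀`, `λ, a > 0` make every unit
  minimiser of `H_L + λW_ε` on `K_L` keep window pair weight `Re ⟨ψ, W_ε ψ⟩ ≥ (Cε + a)L²` at all
  large even `L`, then the body of `WindowGap` holds at `(U, δ)` ("a weak Kac-window pair repulsion
  does not empty the window").
* `windowGap_of_penalisedLRO` — the same with the window weight replaced by its `m = 0` term: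
  `d`-wave pair long-range order `l₀ L⁴ ≤ Re ⟨ψ, Δ_dᴴ Δ_d ψ⟩` of the PENALISED minimisers, with one
  `l₀ > 0` serving every small `ε` (and `λ = λ(ε) > 0`), gives `WindowGap` with `a = l₀/2`,
  `ε = min ε₀ (l₀/(2C + 1))`.
* `windowWeight_of_windowGapAt` — NECESSARY NORMAL FORM: the body of `WindowGap` at `(U, δ)` forces
  `(Cε + a)L² ≤ Re ⟨ψ₀, W_ε ψ₀⟩` on every normalised sector ground state `ψ₀` of the UNPENALISED
  `H_L` (the route's sandwich, isolated).
* `re_dotProduct_kacWindow_mulVec_le_apriori`, `windowGapAt_consts_le` — the A-PRIORI CEILING: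
  `Re ⟨ψ, W_ε ψ⟩ ≤ 32 L²` for every unit Fock vector (Parseval, `wib_sum_pairStructureFactor_le`),
  hence any witness of the crux has `Cε + a ≤ 32`.

These are supports for the crux (`--supports stmt-HubbardSuperconductivity-1088`). H. Tasaki,
*Physics and Mathematics of Quantum Many-Body Systems* (2020) §2.1 (variational principle);
Wang et al., arXiv:2310.05844, §II (observables from two-sided energy sandwiches);
Kennedy–Lieb–Shastry, PRL 61 (1988) 2582 (Parseval sum rule). No new definitions.
-/

-- the mandated namespace `Summit.<Summit>.<Problem>.Theorems` repeats `HubbardSuperconductivity`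
-- (single-problem summit, D-0017), which the `dupNamespace` linter flags on every declaration
set_option linter.dupNamespace false

namespace Summit.HubbardSuperconductivity.HubbardSuperconductivity.Theorems

open Matrix Literature.MathematicalPhysics.QuantumLattice
open Literature.MathematicalPhysics.QuantumLattice.EigenvalueContinuation
  (isCompact_unitSphere_inter continuous_energy)
open Summit.HubbardSuperconductivity.HubbardSuperconductivity.Theses.KacWindowPenalty (WindowGap)

section Abstract

variable {n : Type*} [Fintype n]

/-- **The sector energy is attained.** If the sector `K` contains a unit vector, some unit vector
`ψ ∈ K` has `Re ⟨ψ, A ψ⟩ = minEnergyOn A K` (the unit sphere of `K` is compact and the energy is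
continuous). Tasaki (2020) §2.1. [folklore] -/
theorem exists_unit_re_rayleigh_eq_minEnergyOn (A : Matrix n n ℂ) (K : Submodule ℂ (n → ℂ))
    (hK : ∃ ψ ∈ K, star ψ ⬝ᵥ ψ = 1) :
    ∃ ψ ∈ K, star ψ ⬝ᵥ ψ = 1 ∧ (star ψ ⬝ᵥ A *ᵥ ψ).re = A.minEnergyOn K := by
  obtain ⟨ψ₀, hψ₀K, hψ₀⟩ := hK
  have hne : {w : n → ℂ | w ∈ K ∧ star w ⬝ᵥ w = 1}.Nonempty := ⟨ψ₀, hψ₀K, hψ₀⟩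
  obtain ⟨w, hw, hmin⟩ :=
    (isCompact_unitSphere_inter K).exists_isMinOn hne (continuous_energy A).continuousOn
  refine ⟨w, hw.1, hw.2, ?_⟩
  symm
  refine IsLeast.csInf_eq ⟨⟨w, hw.1, hw.2, rfl⟩, ?_⟩
  rintro E ⟨ψ, hψK, hψ1, rfl⟩
  exact (isMinOn_iff.mp hmin) ψ ⟨hψK, hψ1⟩

/-- **Reverse sandwich (Feynman–Hellmann from the penalised side).** For matrices `H`, `A`, a
sector `K`, a real `λ` and a unit vector `ψ ∈ K` attaining the penalised sector energy,
`Re ⟨ψ, (H + λA) ψ⟩ = minEnergyOn (H + λA) K`, one has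
`λ Re ⟨ψ, A ψ⟩ ≤ minEnergyOn (H + λA) K − minEnergyOn H K`: the variational principle for `H`
at `ψ` reads `minEnergyOn H K ≤ Re ⟨ψ, H ψ⟩ = minEnergyOn (H + λA) K − λ Re ⟨ψ, A ψ⟩`. No sign of
`λ`, no hermiticity and no invariance of `K` are needed. With the route's `Sandwich` (the chord
from the unpenalised side) this gives `λ Re ⟨ψ_λ, A ψ_λ⟩ ≤ gap ≤ λ Re ⟨ψ₀, A ψ₀⟩`.
Tasaki (2020) §2.1; Wang et al., arXiv:2310.05844, §II. [folklore] -/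
theorem smul_re_expect_le_minEnergyOn_add_smul_sub (H A : Matrix n n ℂ)
    (K : Submodule ℂ (n → ℂ)) (lam : ℝ) {ψ : n → ℂ} (hψK : ψ ∈ K) (hψ : star ψ ⬝ᵥ ψ = 1)
    (hmin : (star ψ ⬝ᵥ (H + (lam : ℂ) • A) *ᵥ ψ).re = (H + (lam : ℂ) • A).minEnergyOn K) :
    lam * (star ψ ⬝ᵥ A *ᵥ ψ).re ≤ (H + (lam : ℂ) • A).minEnergyOn K - H.minEnergyOn K := by
  have h1 := minEnergyOn_le_re_rayleigh H K hψK hψ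
  rw [add_mulVec, dotProduct_add, Complex.add_re, smul_mulVec, dotProduct_smul, smul_eq_mul,
    Complex.re_ofReal_mul] at hmin
  linarith

/-- **Penalty gap from the penalised minimisers.** If `K` contains a unit vector and every unit
minimiser `ψ` of `H + λA` on `K` has `b ≤ λ Re ⟨ψ, A ψ⟩`, then
`b ≤ minEnergyOn (H + λA) K − minEnergyOn H K` (a minimiser exists,
`exists_unit_re_rayleigh_eq_minEnergyOn`, and the reverse sandwich applies to it).
Tasaki (2020) §2.1. [folklore] -/
theorem le_minEnergyOn_add_smul_sub_of_forall_minimiser (H A : Matrix n n ℂ)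
    (K : Submodule ℂ (n → ℂ)) (hK : ∃ ψ ∈ K, star ψ ⬝ᵥ ψ = 1) {lam b : ℝ}
    (h : ∀ ψ ∈ K, star ψ ⬝ᵥ ψ = 1 →
      (star ψ ⬝ᵥ (H + (lam : ℂ) • A) *ᵥ ψ).re = (H + (lam : ℂ) • A).minEnergyOn K →
        b ≤ lam * (star ψ ⬝ᵥ A *ᵥ ψ).re) :
    b ≤ (H + (lam : ℂ) • A).minEnergyOn K - H.minEnergyOn K := by
  obtain ⟨ψ, hψK, hψ, hmin⟩ := exists_unit_re_rayleigh_eq_minEnergyOn (H + (lam : ℂ) • A) K hK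
  exact (h ψ hψK hψ hmin).trans (smul_re_expect_le_minEnergyOn_add_smul_sub H A K lam hψK hψ hmin)

end Abstract

/-! ### The route's window operator: a-priori ceiling -/

/-- **A-priori ceiling of the window weight.** For every Fock vector `ψ` with `⟨ψ, ψ⟩ = 1` and
every `ε`, `Re ⟨ψ, W_ε ψ⟩ ≤ 32 L²`: the window expectation is the windowed sum of pair structure
factors (`re_dotProduct_kacWindow_mulVec`), each nonnegative, and the full sum is `≤ 32 L²` by the
Parseval sum rule (`wib_sum_pairStructureFactor_le`). Kennedy–Lieb–Shastry, PRL 61 (1988) 2582.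
[folklore] -/
theorem re_dotProduct_kacWindow_mulVec_le_apriori (L : ℕ) [NeZero L] (ε : ℝ)
    (ψ : Fock (Orb (FermionTorus 2 L))) (hψ : star ψ ⬝ᵥ ψ = 1) :
    (star ψ ⬝ᵥ (∑ m : Fin 2 → ZMod L,
        if (2 * Real.pi / (L : ℝ)) ^ 2 * (∑ i : Fin 2, (((m i).valMinAbs : ℤ) : ℝ) ^ 2) ≤ ε ^ 2 then
          ((L : ℂ) ^ 2)⁻¹ •
            (Matrix.conjTranspose (pairFieldAt dWaveFormFactor L m) * pairFieldAt dWaveFormFactor L m)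
        else 0) *ᵥ ψ).re ≤ 32 * (L : ℝ) ^ 2 := by
  rw [re_dotProduct_kacWindow_mulVec]
  refine le_trans (Finset.sum_le_sum fun m _ => ?_) (wib_sum_pairStructureFactor_le L ψ hψ)
  split_ifs
  · exact le_rfl
  · exact pairStructureFactor_nonneg dWaveFormFactor L ψ m

/-- **Any witness of the crux has `Cε + a ≤ 32`.** If `λ > 0` and
`λ(Cε + a)L² ≤ minEnergyOn (H_L + λW_ε) K_L − minEnergyOn H_L K_L` at one side `L ≥ 1` with
`N_L/2 ≤ L²` pairs (`H_L = hubbardTorus 2 L 1 U`, `K_L = szSector (2n) 0`), then `Cε + a ≤ 32`: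
the sandwich at a normalised sector ground state `ψ₀` (which exists,
`exists_unit_groundStateInSector_hubbardTorus`) bounds the gap by `λ Re ⟨ψ₀, W_ε ψ₀⟩ ≤ 32 λ L²`.
So the crux's order constant is a-priori bounded; only its POSITIVITY uniformly in `L` is at
stake. [folklore] -/
theorem windowGapAt_consts_le (L : ℕ) [NeZero L] (U : ℝ) {n : ℕ} (hn : n ≤ L ^ 2)
    {ε lam C a : ℝ} (hlam : 0 < lam)
    (hgap : lam * (C * ε + a) * (L : ℝ) ^ 2 ≤
      (hubbardTorus 2 L 1 U + (lam : ℂ) • (∑ m : Fin 2 → ZMod L,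
          if (2 * Real.pi / (L : ℝ)) ^ 2 * (∑ i : Fin 2, (((m i).valMinAbs : ℤ) : ℝ) ^ 2) ≤ ε ^ 2 then
            ((L : ℂ) ^ 2)⁻¹ •
              (Matrix.conjTranspose (pairFieldAt dWaveFormFactor L m) *
                pairFieldAt dWaveFormFactor L m)
          else 0)).minEnergyOn (szSector (2 * n) 0) -
        (hubbardTorus 2 L 1 U).minEnergyOn (szSector (2 * n) 0)) :
    C * ε + a ≤ 32 := by
  have hL : (0 : ℝ) < (L : ℝ) := Nat.cast_pos.2 (Nat.pos_of_ne_zero (NeZero.ne L))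
  have hL2 : (0 : ℝ) < (L : ℝ) ^ 2 := by positivity
  obtain ⟨ψ₀, hψ₀, hgs⟩ :=
    Summit.HubbardSuperconductivity.NoGo.exists_unit_groundStateInSector_hubbardTorus L 1 U hn
  have hs := le_trans hgap
    ((div_le_iff₀ hlam).1 (chord_div_le_re_expect_of_eigen _ _ _ hlam hgs.1 hψ₀ hgs.2.2))
  have hw := re_dotProduct_kacWindow_mulVec_le_apriori L ε ψ₀ hψ₀
  have h1 : lam * (C * ε + a) * (L : ℝ) ^ 2 ≤ lam * 32 * (L : ℝ) ^ 2 := by nlinarith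
  have h2 : lam * (C * ε + a) ≤ lam * 32 := le_of_mul_le_mul_right h1 hL2
  exact le_of_mul_le_mul_left h2 hlam

/-! ### Necessary normal form: the unpenalised ground states carry the window weight -/

/-- **Gap ⇒ window weight of every unpenalised ground state** (the route's sandwich, isolated
at one side). If `λ > 0` and `λ B ≤ minEnergyOn (H_L + λW_ε) K − minEnergyOn H_L K` with
`K = szSector N 0`, then every normalised sector ground state `ψ₀` of `H_L = hubbardTorus 2 L 1 U`
has `B ≤ Re ⟨ψ₀, W_ε ψ₀⟩` (`chord_div_le_re_expect_of_eigen`). In the crux `B = (Cε + a)L²`: an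
extensive window gap needs extensive window pair weight — `d`-wave window "condensation" — in
EVERY unpenalised sector ground state. Tasaki (2020) §2.1; Wang et al., arXiv:2310.05844, §II.
[folklore] -/
theorem windowWeight_of_windowGapAt (L : ℕ) [NeZero L] (U : ℝ) (N : ℕ) {ε lam B : ℝ}
    (hlam : 0 < lam)
    (hgap : lam * B ≤
      (hubbardTorus 2 L 1 U + (lam : ℂ) • (∑ m : Fin 2 → ZMod L,
          if (2 * Real.pi / (L : ℝ)) ^ 2 * (∑ i : Fin 2, (((m i).valMinAbs : ℤ) : ℝ) ^ 2) ≤ ε ^ 2 then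
            ((L : ℂ) ^ 2)⁻¹ •
              (Matrix.conjTranspose (pairFieldAt dWaveFormFactor L m) *
                pairFieldAt dWaveFormFactor L m)
          else 0)).minEnergyOn (szSector N 0) -
        (hubbardTorus 2 L 1 U).minEnergyOn (szSector N 0))
    {ψ₀ : Fock (Orb (FermionTorus 2 L))} (hψ₀ : star ψ₀ ⬝ᵥ ψ₀ = 1)
    (hgs : IsGroundStateInSector (hubbardTorus 2 L 1 U) N 0 ψ₀) :
    B ≤ (star ψ₀ ⬝ᵥ (∑ m : Fin 2 → ZMod L,
        if (2 * Real.pi / (L : ℝ)) ^ 2 * (∑ i : Fin 2, (((m i).valMinAbs : ℤ) : ℝ) ^ 2) ≤ ε ^ 2 then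
          ((L : ℂ) ^ 2)⁻¹ •
            (Matrix.conjTranspose (pairFieldAt dWaveFormFactor L m) * pairFieldAt dWaveFormFactor L m)
        else 0) *ᵥ ψ₀).re := by
  have hs := le_trans hgap
    ((div_le_iff₀ hlam).1 (chord_div_le_re_expect_of_eigen _ _ _ hlam hgs.1 hψ₀ hgs.2.2))
  rw [mul_comm] at hs
  exact le_of_mul_le_mul_right hs hlam

/-! ### Sufficient normal forms: the penalised minimisers keep the window weight -/

/-- **WindowGap at `(U, δ)` from persistence of the window weight under the penalty.** Suppose
that at `(U, δ)`, for every `C ≥ 0` and `ε₀ > 0` there are `ε ∈ (0, ε₀]`, `λ, a > 0`, `L₀` such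
that at every even `L ≥ L₀` every unit vector `ψ ∈ K_L = szSector N_L 0` attaining the PENALISED
sector energy, `Re ⟨ψ, (H_L + λW_ε) ψ⟩ = minEnergyOn (H_L + λW_ε) K_L`, keeps window pair weight
`(Cε + a)L² ≤ Re ⟨ψ, W_ε ψ⟩`. Then the body of `WindowGap` holds at `(U, δ)` with the same data:
the reverse sandwich `λ Re ⟨ψ, W_ε ψ⟩ ≤ gap` at a minimiser (which exists: `K_L` contains the unit
ground state of `exists_unit_groundStateInSector_hubbardTorus`). This is the reading "a weak
Kac-window pair repulsion does not empty the window"; the converse direction (gap ⇒ weight of the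
UNPENALISED ground states) is `windowWeight_of_windowGapAt`. Tasaki (2020) §2.1. [folklore] -/
theorem windowGapAt_of_penalisedWindowWeight {U δ : ℝ} (hδ : δ ∈ Set.Ioo (0 : ℝ) (1 / 2))
    (h : ∀ C : ℝ, 0 ≤ C → ∀ ε₀ : ℝ, 0 < ε₀ → ∃ ε ∈ Set.Ioc (0 : ℝ) ε₀, ∃ lam a : ℝ, 0 < lam ∧ 0 < a ∧
      ∃ L₀ : ℕ, ∀ (L : ℕ) [NeZero L], L₀ ≤ L → Even L →
        ∀ ψ : Fock (Orb (FermionTorus 2 L)), ψ ∈ szSector (2 * ⌊(1 - δ) * (L : ℝ) ^ 2 / 2⌋₊) 0 →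
          star ψ ⬝ᵥ ψ = 1 →
          (star ψ ⬝ᵥ (hubbardTorus 2 L 1 U + (lam : ℂ) • (∑ m : Fin 2 → ZMod L,
              if (2 * Real.pi / (L : ℝ)) ^ 2 * (∑ i : Fin 2, (((m i).valMinAbs : ℤ) : ℝ) ^ 2) ≤ ε ^ 2
              then ((L : ℂ) ^ 2)⁻¹ • (Matrix.conjTranspose (pairFieldAt dWaveFormFactor L m) *
                pairFieldAt dWaveFormFactor L m)
              else 0)) *ᵥ ψ).re =
            (hubbardTorus 2 L 1 U + (lam : ℂ) • (∑ m : Fin 2 → ZMod L,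
              if (2 * Real.pi / (L : ℝ)) ^ 2 * (∑ i : Fin 2, (((m i).valMinAbs : ℤ) : ℝ) ^ 2) ≤ ε ^ 2
              then ((L : ℂ) ^ 2)⁻¹ • (Matrix.conjTranspose (pairFieldAt dWaveFormFactor L m) *
                pairFieldAt dWaveFormFactor L m)
              else 0)).minEnergyOn (szSector (2 * ⌊(1 - δ) * (L : ℝ) ^ 2 / 2⌋₊) 0) →
          (C * ε + a) * (L : ℝ) ^ 2 ≤
            (star ψ ⬝ᵥ (∑ m : Fin 2 → ZMod L,
              if (2 * Real.pi / (L : ℝ)) ^ 2 * (∑ i : Fin 2, (((m i).valMinAbs : ℤ) : ℝ) ^ 2) ≤ ε ^ 2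
              then ((L : ℂ) ^ 2)⁻¹ • (Matrix.conjTranspose (pairFieldAt dWaveFormFactor L m) *
                pairFieldAt dWaveFormFactor L m)
              else 0) *ᵥ ψ).re) :
    ∀ C : ℝ, 0 ≤ C → ∀ ε₀ : ℝ, 0 < ε₀ → ∃ ε ∈ Set.Ioc (0 : ℝ) ε₀, ∃ lam a : ℝ, 0 < lam ∧ 0 < a ∧
      ∃ L₀ : ℕ, ∀ (L : ℕ) [NeZero L], L₀ ≤ L → Even L →
        lam * (C * ε + a) * (L : ℝ) ^ 2 ≤
          (hubbardTorus 2 L 1 U + (lam : ℂ) • (∑ m : Fin 2 → ZMod L,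
              if (2 * Real.pi / (L : ℝ)) ^ 2 * (∑ i : Fin 2, (((m i).valMinAbs : ℤ) : ℝ) ^ 2) ≤ ε ^ 2
              then ((L : ℂ) ^ 2)⁻¹ • (Matrix.conjTranspose (pairFieldAt dWaveFormFactor L m) *
                pairFieldAt dWaveFormFactor L m)
              else 0)).minEnergyOn (szSector (2 * ⌊(1 - δ) * (L : ℝ) ^ 2 / 2⌋₊) 0) -
            (hubbardTorus 2 L 1 U).minEnergyOn (szSector (2 * ⌊(1 - δ) * (L : ℝ) ^ 2 / 2⌋₊) 0) := by
  intro C hC ε₀ hε₀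
  obtain ⟨ε, hε, lam, a, hlam, ha, L₀, hL⟩ := h C hC ε₀ hε₀
  refine ⟨ε, hε, lam, a, hlam, ha, L₀, ?_⟩
  intro L _ hL₀ hE
  obtain ⟨ψ₀, hψ₀, hψ₀gs⟩ :=
    Summit.HubbardSuperconductivity.NoGo.exists_unit_groundStateInSector_hubbardTorus L 1 U
      (Summit.HubbardSuperconductivity.NoGo.floor_pairNumber_le δ (by linarith [hδ.1]) L)
  refine le_minEnergyOn_add_smul_sub_of_forall_minimiser (hubbardTorus 2 L 1 U) _
    (szSector (2 * ⌊(1 - δ) * (L : ℝ) ^ 2 / 2⌋₊) 0) ⟨ψ₀, hψ₀gs.1, hψ₀⟩ ?_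
  intro ψ hψK hψ hmin
  have hw := hL L hL₀ hE ψ hψK hψ hmin
  calc lam * (C * ε + a) * (L : ℝ) ^ 2 = lam * ((C * ε + a) * (L : ℝ) ^ 2) := by ring
    _ ≤ _ := mul_le_mul_of_nonneg_left hw hlam.le

/-- **Sufficient normal form of the crux `WindowGap`** (stmt-HubbardSuperconductivity-1088):
persistence of the window pair weight in the penalised minimisers at SOME `U > 0`,
`δ ∈ (0, 1/2)` (hypothesis of `windowGapAt_of_penalisedWindowWeight`) implies `WindowGap`.
Tasaki (2020) §2.1. [folklore] -/
theorem windowGap_of_penalisedWindowWeight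
    (h : ∃ U : ℝ, 0 < U ∧ ∃ δ ∈ Set.Ioo (0 : ℝ) (1 / 2),
      ∀ C : ℝ, 0 ≤ C → ∀ ε₀ : ℝ, 0 < ε₀ → ∃ ε ∈ Set.Ioc (0 : ℝ) ε₀, ∃ lam a : ℝ, 0 < lam ∧ 0 < a ∧
      ∃ L₀ : ℕ, ∀ (L : ℕ) [NeZero L], L₀ ≤ L → Even L →
        ∀ ψ : Fock (Orb (FermionTorus 2 L)), ψ ∈ szSector (2 * ⌊(1 - δ) * (L : ℝ) ^ 2 / 2⌋₊) 0 →
          star ψ ⬝ᵥ ψ = 1 →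
          (star ψ ⬝ᵥ (hubbardTorus 2 L 1 U + (lam : ℂ) • (∑ m : Fin 2 → ZMod L,
              if (2 * Real.pi / (L : ℝ)) ^ 2 * (∑ i : Fin 2, (((m i).valMinAbs : ℤ) : ℝ) ^ 2) ≤ ε ^ 2
              then ((L : ℂ) ^ 2)⁻¹ • (Matrix.conjTranspose (pairFieldAt dWaveFormFactor L m) *
                pairFieldAt dWaveFormFactor L m)
              else 0)) *ᵥ ψ).re =
            (hubbardTorus 2 L 1 U + (lam : ℂ) • (∑ m : Fin 2 → ZMod L,
              if (2 * Real.pi / (L : ℝ)) ^ 2 * (∑ i : Fin 2, (((m i).valMinAbs : ℤ) : ℝ) ^ 2) ≤ ε ^ 2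
              then ((L : ℂ) ^ 2)⁻¹ • (Matrix.conjTranspose (pairFieldAt dWaveFormFactor L m) *
                pairFieldAt dWaveFormFactor L m)
              else 0)).minEnergyOn (szSector (2 * ⌊(1 - δ) * (L : ℝ) ^ 2 / 2⌋₊) 0) →
          (C * ε + a) * (L : ℝ) ^ 2 ≤
            (star ψ ⬝ᵥ (∑ m : Fin 2 → ZMod L,
              if (2 * Real.pi / (L : ℝ)) ^ 2 * (∑ i : Fin 2, (((m i).valMinAbs : ℤ) : ℝ) ^ 2) ≤ ε ^ 2
              then ((L : ℂ) ^ 2)⁻¹ • (Matrix.conjTranspose (pairFieldAt dWaveFormFactor L m) *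
                pairFieldAt dWaveFormFactor L m)
              else 0) *ᵥ ψ).re) :
    WindowGap := by
  obtain ⟨U, hU, δ, hδ, h⟩ := h
  exact ⟨U, hU, δ, hδ, windowGapAt_of_penalisedWindowWeight hδ h⟩

/-- The window weight dominates its zero mode: for every `ε` (the label `m = 0` always lies in
the window, `valMinAbs 0 = 0`) and every Fock vector `ψ`,
`Re ⟨ψ, Δ_dᴴ Δ_d ψ⟩ / L² ≤ Re ⟨ψ, W_ε ψ⟩` (drop the nonnegative `m ≠ 0` structure factors;
`Δ_d(0) = pairField`, `pairFieldAt_zero`). Scalapino, Phys. Rep. 250 (1995) 329, §2. [folklore] -/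
theorem re_expect_pairField_div_le_re_dotProduct_kacWindow_mulVec (L : ℕ) [NeZero L] (ε : ℝ)
    (ψ : Fock (Orb (FermionTorus 2 L))) :
    (expect ((pairField dWaveFormFactor L)ᴴ * pairField dWaveFormFactor L) ψ).re / (L : ℝ) ^ 2 ≤
      (star ψ ⬝ᵥ (∑ m : Fin 2 → ZMod L,
        if (2 * Real.pi / (L : ℝ)) ^ 2 * (∑ i : Fin 2, (((m i).valMinAbs : ℤ) : ℝ) ^ 2) ≤ ε ^ 2 then
          ((L : ℂ) ^ 2)⁻¹ •
            (Matrix.conjTranspose (pairFieldAt dWaveFormFactor L m) * pairFieldAt dWaveFormFactor L m)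
        else 0) *ᵥ ψ).re := by
  rw [re_dotProduct_kacWindow_mulVec]
  have hw0 : (2 * Real.pi / (L : ℝ)) ^ 2 *
      (∑ i : Fin 2, ((((0 : Fin 2 → ZMod L) i).valMinAbs : ℤ) : ℝ) ^ 2) ≤ ε ^ 2 := by
    have h0 : ∀ i : Fin 2, ((((0 : Fin 2 → ZMod L) i).valMinAbs : ℤ) : ℝ) ^ 2 = 0 := fun i => by
      rw [Pi.zero_apply, ZMod.valMinAbs_zero, Int.cast_zero, sq, mul_zero]
    rw [Finset.sum_congr rfl fun i _ => h0 i, Finset.sum_const_zero, mul_zero]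
    positivity
  have hterm : (expect ((pairField dWaveFormFactor L)ᴴ * pairField dWaveFormFactor L) ψ).re /
        (L : ℝ) ^ 2 =
      (if (2 * Real.pi / (L : ℝ)) ^ 2 *
            (∑ i : Fin 2, ((((0 : Fin 2 → ZMod L) i).valMinAbs : ℤ) : ℝ) ^ 2) ≤ ε ^ 2 then
          (star (Matrix.mulVec (pairFieldAt dWaveFormFactor L 0) ψ) ⬝ᵥ
              Matrix.mulVec (pairFieldAt dWaveFormFactor L 0) ψ).re / (L : ℝ) ^ 2
        else 0) := by
    rw [if_pos hw0, pairFieldAt_zero, star_mulVec_dotProduct_mulVec]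
    rfl
  rw [hterm]
  refine Finset.single_le_sum (f := fun m : Fin 2 → ZMod L =>
      if (2 * Real.pi / (L : ℝ)) ^ 2 * (∑ i : Fin 2, (((m i).valMinAbs : ℤ) : ℝ) ^ 2) ≤ ε ^ 2 then
        (star (Matrix.mulVec (pairFieldAt dWaveFormFactor L m) ψ) ⬝ᵥ
            Matrix.mulVec (pairFieldAt dWaveFormFactor L m) ψ).re / (L : ℝ) ^ 2
      else 0) (fun m _ => ?_) (Finset.mem_univ (0 : Fin 2 → ZMod L))
  split_ifs
  · exact pairStructureFactor_nonneg dWaveFormFactor L ψ m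
  · exact le_rfl

/-- **`WindowGap` from `d`-wave long-range order of the PENALISED minimisers.** Suppose at some
`U > 0`, `δ ∈ (0, 1/2)` there is ONE order constant `l₀ > 0` such that for every `ε > 0` some
coupling `λ = λ(ε) > 0` and threshold `L₀` make every unit minimiser `ψ` of `H_L + λW_ε` on
`K_L = szSector N_L 0` carry `d`-wave pair long-range order `l₀ L⁴ ≤ Re ⟨ψ, Δ_dᴴ Δ_d ψ⟩` at all even
`L ≥ L₀` ("the condensate survives a weak Kac-window pair repulsion, uniformly in the window
radius"). Then `WindowGap`: given `C ≥ 0`, `ε₀ > 0` take `ε := min ε₀ (l₀ / (2C + 1))` (so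
`Cε ≤ l₀/2`), `λ := λ(ε)`, `a := l₀/2`; the window weight of a minimiser dominates its zero mode
`Re ⟨ψ, Δ_dᴴ Δ_d ψ⟩ / L² ≥ l₀ L² ≥ (Cε + a)L²`
(`re_expect_pairField_div_le_re_dotProduct_kacWindow_mulVec`), and
`windowGap_of_penalisedWindowWeight` concludes. The physics expects `λ(ε) ≍ ρ_s ε²`
(route docstring, mechanism (iii)). Tasaki (2020) §2.1; Scalapino, Phys. Rep. 250 (1995) 329, §2.
[folklore] -/
theorem windowGap_of_penalisedLRO
    (h : ∃ U : ℝ, 0 < U ∧ ∃ δ ∈ Set.Ioo (0 : ℝ) (1 / 2), ∃ l₀ : ℝ, 0 < l₀ ∧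
      ∀ ε : ℝ, 0 < ε → ∃ lam : ℝ, 0 < lam ∧ ∃ L₀ : ℕ, ∀ (L : ℕ) [NeZero L], L₀ ≤ L → Even L →
        ∀ ψ : Fock (Orb (FermionTorus 2 L)), ψ ∈ szSector (2 * ⌊(1 - δ) * (L : ℝ) ^ 2 / 2⌋₊) 0 →
          star ψ ⬝ᵥ ψ = 1 →
          (star ψ ⬝ᵥ (hubbardTorus 2 L 1 U + (lam : ℂ) • (∑ m : Fin 2 → ZMod L,
              if (2 * Real.pi / (L : ℝ)) ^ 2 * (∑ i : Fin 2, (((m i).valMinAbs : ℤ) : ℝ) ^ 2) ≤ ε ^ 2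
              then ((L : ℂ) ^ 2)⁻¹ • (Matrix.conjTranspose (pairFieldAt dWaveFormFactor L m) *
                pairFieldAt dWaveFormFactor L m)
              else 0)) *ᵥ ψ).re =
            (hubbardTorus 2 L 1 U + (lam : ℂ) • (∑ m : Fin 2 → ZMod L,
              if (2 * Real.pi / (L : ℝ)) ^ 2 * (∑ i : Fin 2, (((m i).valMinAbs : ℤ) : ℝ) ^ 2) ≤ ε ^ 2
              then ((L : ℂ) ^ 2)⁻¹ • (Matrix.conjTranspose (pairFieldAt dWaveFormFactor L m) *
                pairFieldAt dWaveFormFactor L m)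
              else 0)).minEnergyOn (szSector (2 * ⌊(1 - δ) * (L : ℝ) ^ 2 / 2⌋₊) 0) →
          l₀ * (L : ℝ) ^ 4 ≤
            (expect ((pairField dWaveFormFactor L)ᴴ * pairField dWaveFormFactor L) ψ).re) :
    WindowGap := by
  obtain ⟨U, hU, δ, hδ, l₀, hl₀, h⟩ := h
  refine windowGap_of_penalisedWindowWeight ⟨U, hU, δ, hδ, ?_⟩
  intro C hC ε₀ hε₀
  have hden : (0 : ℝ) < 2 * C + 1 := by linarith
  have hq : 0 < l₀ / (2 * C + 1) := div_pos hl₀ hden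
  set ε : ℝ := min ε₀ (l₀ / (2 * C + 1)) with hεdef
  have hεpos : 0 < ε := lt_min hε₀ hq
  have hεε₀ : ε ≤ ε₀ := min_le_left _ _
  have hεq : ε ≤ l₀ / (2 * C + 1) := min_le_right _ _
  -- `C ε ≤ l₀ / 2`
  have hCε : C * ε ≤ l₀ / 2 := by
    have h1 : C * ε ≤ C * (l₀ / (2 * C + 1)) := mul_le_mul_of_nonneg_left hεq hC
    have h2 : C * (l₀ / (2 * C + 1)) ≤ l₀ / 2 := by
      rw [mul_div_assoc', div_le_div_iff₀ hden two_pos]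
      nlinarith
    linarith
  obtain ⟨lam, hlam, L₀, hL⟩ := h ε hεpos
  refine ⟨ε, ⟨hεpos, hεε₀⟩, lam, l₀ / 2, hlam, half_pos hl₀, L₀, ?_⟩
  intro L _ hL₀ hE ψ hψK hψ hmin
  have hLpos : (0 : ℝ) < (L : ℝ) := Nat.cast_pos.2 (Nat.pos_of_ne_zero (NeZero.ne L))
  have hL2 : (0 : ℝ) < (L : ℝ) ^ 2 := by positivity
  have hlro := hL L hL₀ hE ψ hψK hψ hmin
  have hdom := re_expect_pairField_div_le_re_dotProduct_kacWindow_mulVec L ε ψ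
  have h1 : l₀ * (L : ℝ) ^ 2 ≤
      (expect ((pairField dWaveFormFactor L)ᴴ * pairField dWaveFormFactor L) ψ).re / (L : ℝ) ^ 2 := by
    rw [le_div_iff₀ hL2]
    calc l₀ * (L : ℝ) ^ 2 * (L : ℝ) ^ 2 = l₀ * (L : ℝ) ^ 4 := by ring
      _ ≤ _ := hlro
  have h2 : (C * ε + l₀ / 2) * (L : ℝ) ^ 2 ≤ l₀ * (L : ℝ) ^ 2 :=
    mul_le_mul_of_nonneg_right (by linarith) hL2.le
  exact h2.trans (h1.trans hdom)

end Summit.HubbardSuperconductivity.HubbardSuperconductivity.Theorems
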